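import Summits.PneNP.PneNP.Theses.Learning
import Literature.Computability.MetaComplexity.AvgCaseCertifiedHardness
import Literature.Computability.MetaComplexity.MCSPStatisticalTest
import Literature.Computability.Learning.SizeClassCounting
import Literature.Computability.Complexity.CircuitClassesUniformProofs
import Literature.Computability.Complexity.StringCopy
import Literature.Computability.Complexity.PRelHierarchy
import Literature.Computability.Complexity.CodeFPArith
import Literature.Computability.Complexity.CodeFPLists
import Literature.Computability.AlgebraicComplexity.RazElusiveGeneralExistence

/-!
# Route Learning — `LearningNoNaturalPropertyImpliesPNeNP` (stmt-PneNP-0419)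

Razborov–Rudich's remark (Arora–Barak Example 23.2 with Thm. 6.21): if `P = NP` then the property
`Rₙ = {f | circuitSizeOver B2 f > 2^{⌊n/4⌋}}` is `P/poly`-natural and useful against `P/poly`:

* useful: `n^k ≤ 2^{⌊n/4⌋}` eventually (`eventually_pow_le_two_pow_div_four`);
* large: at most `2^{9(n + 2^{⌊n/4⌋} + 2)²} ≤ 2^{2ⁿ - 1}` functions have small circuits
  (`Learning.ncard_sizeClass_B2_le`, `CertifiedHard.exponent_le`), so `|Rₙ| ≥ 2^{2ⁿ}/2`;
* constructive: its truth-table language is `(MCSP[2^{⌊n/4⌋}])ᶜ ∩ {w : |w| is a power of two}`;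
  `MCSP[2^{⌊n/4⌋}] ∈ NP = P` (`CertifiedHard.MCSPSize_quarterExp_mem_NP`), `P` is closed under
  complement and intersection, the power-of-two length test is a typed `CodeFP` program, and `P ⊆ P/poly`.

Hence "no `P/poly`-natural property useful against `P/poly`" implies `P ≠ NP`.
-/

set_option linter.dupNamespace false -- `Summit.PneNP.PneNP.…`: summit = sub-problem name (D-0017 single-conjunct layout)

namespace Summit.PneNP.PneNP.Theorems

open Filter _root_.Computability
open Literature.Computability.Complexity Literature.Computability.Complexity.CodeFP
open Literature.Computability.MetaComplexity Literature.Computability.Learning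

/-- **Usefulness**: the property `{f | circuitSizeOver B2 f > 2^{⌊n/4⌋}}` is useful against `n^k`-size
circuits for every `k`. [cite: AroraBarak2009, Example 23.2] -/
theorem learningNoNatural_useful :
    IsUsefulAgainstPPoly fun n => {f | CertifiedHard.quarterExp n < circuitSizeOver B2 f} := by
  intro k
  obtain ⟨n₀, hn₀⟩ := Literature.Computability.AlgebraicComplexity.eventually_pow_le_two_pow_div_four k
  exact eventually_atTop.2 ⟨n₀, fun n hn f hf => lt_of_le_of_lt (hn₀ n hn) hf⟩

/-- **Largeness** (Shannon counting, Arora–Barak Thm. 6.21): for `n ≥ 4360` at least half of all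
`n`-variable Boolean functions have `B₂`-circuit complexity `> 2^{⌊n/4⌋}`. [cite: AroraBarak2009, Thm. 6.21] -/
theorem learningNoNatural_large :
    IsLarge fun n => {f | CertifiedHard.quarterExp n < circuitSizeOver B2 f} := by
  refine ⟨1, eventually_atTop.2 ⟨4 * 1090, fun n hn => ?_⟩⟩
  set R : Set ((Fin n → Bool) → Bool) := {f | CertifiedHard.quarterExp n < circuitSizeOver B2 f}
    with hR
  have hcompl : Rᶜ ⊆ sizeClass B2 CertifiedHard.quarterExp n := by
    intro f hf
    simp only [hR, Set.mem_compl_iff, Set.mem_setOf_eq, not_lt] at hf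
    obtain ⟨C, hB, hC, hsize⟩ := exists_computes_B2_size_eq_holds f
    exact ⟨C, hB, hC, hsize ▸ hf⟩
  have hexp : 1 + 0 * n + 9 * (n + 2 ^ (n / 4) + 2) ^ 2 ≤ 2 ^ n :=
    CertifiedHard.exponent_le 0 n (by omega)
  have hcnt : Rᶜ.ncard ≤ 2 ^ (2 ^ n - 1) := by
    calc Rᶜ.ncard ≤ (sizeClass B2 CertifiedHard.quarterExp n).ncard :=
          Set.ncard_le_ncard hcompl (Set.toFinite _)
      _ ≤ 2 ^ (9 * (n + CertifiedHard.quarterExp n + 2) ^ 2) :=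
          ncard_sizeClass_B2_le CertifiedHard.quarterExp n
      _ ≤ 2 ^ (2 ^ n - 1) := by
          apply Nat.pow_le_pow_right two_pos
          unfold CertifiedHard.quarterExp
          omega
  have htot : R.ncard + Rᶜ.ncard = 2 ^ (2 ^ n) := by
    rw [Set.ncard_add_ncard_compl]
    simp only [Nat.card_eq_fintype_card, Fintype.card_fun, Fintype.card_bool, Fintype.card_fin]
  have hA : 2 ^ (2 ^ n) = 2 * 2 ^ (2 ^ n - 1) := by
    rw [← Nat.pow_succ']
    congr 1
    have := Nat.one_le_two_pow (n := n)
    omega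
  have h2 : 2 ≤ 2 ^ (1 * n) := by
    rw [one_mul]
    calc (2 : ℕ) = 2 ^ 1 := rfl
      _ ≤ 2 ^ n := Nat.pow_le_pow_right two_pos (by omega)
  rw [Nat.card_coe_set_eq]
  rw [hA] at htot
  have hRA : 2 ^ (2 ^ n - 1) ≤ R.ncard := by omega
  calc 2 ^ (2 ^ n) = 2 * 2 ^ (2 ^ n - 1) := hA
    _ ≤ 2 ^ (1 * n) * R.ncard := Nat.mul_le_mul h2 hRA

/-- A natural number is a power of two iff it is positive and every divisor `≥ 2` of it is even.
[folklore] -/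
theorem learningNoNatural_powTwo_iff (m : ℕ) :
    (0 < m ∧ ∀ d < m, d + 1 < 2 ∨ ¬ m % (d + 1) = 0 ∨ (d + 1) % 2 = 0) ↔ ∃ k, m = 2 ^ k := by
  constructor
  · rintro ⟨hm, h⟩
    obtain ⟨k, r, hr, rfl⟩ := Nat.exists_eq_two_pow_mul_odd hm.ne'
    by_cases hr1 : r = 1
    · exact ⟨k, by rw [hr1, mul_one]⟩
    · exfalso
      have hr0 : 0 < r := hr.pos
      have hodd : r % 2 = 1 := Nat.odd_iff.1 hr
      have hle : r ≤ 2 ^ k * r := Nat.le_mul_of_pos_left r (Nat.two_pow_pos k)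
      rcases h (r - 1) (by omega) with h1 | h1 | h1
      · omega
      · rw [Nat.sub_add_cancel hr0] at h1
        exact h1 (Nat.mod_eq_zero_of_dvd (dvd_mul_left r (2 ^ k)))
      · rw [Nat.sub_add_cancel hr0] at h1
        omega
  · rintro ⟨k, rfl⟩
    refine ⟨Nat.two_pow_pos k, fun d _ => ?_⟩
    by_cases hmod : 2 ^ k % (d + 1) = 0
    · obtain ⟨j, -, hj⟩ := (Nat.dvd_prime_pow Nat.prime_two).1 (Nat.dvd_of_mod_eq_zero hmod)
      rcases j with _ | j
      · left
        rw [hj]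
        norm_num
      · right; right
        rw [hj, Nat.pow_succ]
        exact Nat.mul_mod_left _ _
    · exact Or.inr (Or.inl hmod)

/-- **The power-of-two length test as a typed program**: `w ↦ [0 < |w| ∧ every divisor d+1 ≥ 2 of |w|
with d < |w| is even]`. [cite: AroraBarak2009, §1.3] [folklore] -/
theorem learningNoNatural_powTwoTest_codeFP :
    CodeFP strE bitE fun w : List Bool =>
      decide (0 < w.length) &&
        (List.range (min w.length w.length)).all fun d =>
          decide (d + 1 < 2) || (!decide (w.length % (d + 1) = 0) || decide ((d + 1) % 2 = 0)) := by
  have hlenU : CodeFP strE unE fun w : List Bool => w.length := strLength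
  have hlen : CodeFP strE natE fun w : List Bool => w.length := (natOfUn.comp hlenU :)
  have hR : CodeFP strE (rawE natE) fun w : List Bool => List.range (min w.length w.length) :=
    (rangeOf.comp (hlenU.pair hlen) :)
  have hd1 : CodeFP (pairE strE natE) natE fun q : List Bool × ℕ => q.2 + 1 :=
    (natAdd.comp ((CodeFP.snd _ _).pair (CodeFP.const _ 1)) :)
  have hl : CodeFP (pairE strE natE) natE fun q : List Bool × ℕ => q.1.length :=
    (hlen.comp (CodeFP.fst _ _) :)
  have hlt : CodeFP (pairE strE natE) bitE fun q : List Bool × ℕ => decide (q.2 + 1 < 2) :=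
    (natLt.comp (hd1.pair (CodeFP.const _ 2)) :)
  have hmod : CodeFP (pairE strE natE) bitE fun q : List Bool × ℕ =>
      decide (q.1.length % (q.2 + 1) = 0) :=
    (natEq.comp ((natMod.comp (hl.pair hd1)).pair (CodeFP.const _ 0)) :)
  have hev : CodeFP (pairE strE natE) bitE fun q : List Bool × ℕ => decide ((q.2 + 1) % 2 = 0) :=
    (natEq.comp ((natMod.comp (hd1.pair (CodeFP.const _ 2))).pair (CodeFP.const _ 0)) :)
  have hP : CodeFP (pairE strE natE) bitE fun q : List Bool × ℕ =>
      decide (q.2 + 1 < 2) || (!decide (q.1.length % (q.2 + 1) = 0) || decide ((q.2 + 1) % 2 = 0)) :=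
    hlt.or (hmod.not.or hev)
  have hall : CodeFP strE bitE fun w : List Bool => (List.range (min w.length w.length)).all fun d =>
      decide (d + 1 < 2) || (!decide (w.length % (d + 1) = 0) || decide ((d + 1) % 2 = 0)) :=
    ((CodeFP.all hP).comp ((CodeFP.id _).pair hR) :)
  have hpos : CodeFP strE bitE fun w : List Bool => decide (0 < w.length) :=
    (natLt.comp ((CodeFP.const _ 0).pair hlen) :)
  exact hpos.and hall

/-- **The set of all truth tables is in `P`**: the language of strings whose length is a power of two.
[cite: AroraBarak2009, §1.3] [folklore] -/
theorem learningNoNatural_exists_ttLang :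
    ∃ T : Language Bool, T ∈ Classes.P ∧ ∀ w : List Bool, w ∈ T ↔ ∃ k, w.length = 2 ^ k := by
  obtain ⟨g, hg, hgspec⟩ := learningNoNatural_powTwoTest_codeFP
  refine ⟨g ⁻¹' PRelSigma.HeadIs true, preimage_mem_P (PRelSigma.HeadIs_mem_P true) hg, fun w => ?_⟩
  change (g (strE w)).head? = some true ↔ _
  rw [hgspec, ← learningNoNatural_powTwo_iff]
  simp only [bitE, List.head?_cons, Option.some.injEq, Bool.and_eq_true, decide_eq_true_eq,
    List.all_eq_true, List.mem_range, Bool.or_eq_true, Bool.not_eq_true', decide_eq_false_iff_not,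
    min_self]

/-- **Constructivity under `P = NP`**: the truth-table language of the property is
`(MCSP[2^{⌊n/4⌋}])ᶜ ∩ {all truth tables} ∈ P ⊆ P/poly`. [cite: AroraBarak2009, Example 23.2]
[cite: KabanetsCai2000, §2] -/
theorem learningNoNatural_constructive (hPNP : Classes.P = Nondeterministic.NP) :
    IsConstructive PPoly fun n => {f | CertifiedHard.quarterExp n < circuitSizeOver B2 f} := by
  obtain ⟨T, hT, hTspec⟩ := learningNoNatural_exists_ttLang
  have hS : (MCSPSize CertifiedHard.quarterExp)ᶜ ∈ Classes.P := by
    rw [compl_mem_P_iff, hPNP]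
    exact CertifiedHard.MCSPSize_quarterExp_mem_NP
  have heq : truthTableLanguage (fun n => {f | CertifiedHard.quarterExp n < circuitSizeOver B2 f}) =
      (MCSPSize CertifiedHard.quarterExp)ᶜ ⊓ T := by
    ext w
    constructor
    · rintro ⟨n, f, rfl, hf⟩
      exact ⟨(truthTable_mem_compl_MCSPSize_iff _ f).2 hf, (hTspec _).2 ⟨n, length_truthTable f⟩⟩
    · rintro ⟨hw, hwT⟩
      obtain ⟨n, hn⟩ := (hTspec w).1 hwT
      exact ⟨n, ofTruthTable w hn, (truthTable_ofTruthTable w hn).symm,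
        (mem_compl_MCSPSize_iff_of_length_eq CertifiedHard.quarterExp w hn).1 hw⟩
  unfold IsConstructive
  rw [CombinatorialProperty.toLanguage_eq, heq]
  exact P_subset_PPoly_holds (inter_mem_P hS hT)

/-- **stmt-PneNP-0419** `LearningNoNaturalPropertyImpliesPNeNP`: if no `P/poly`-natural property is
useful against `P/poly`, then `P ≠ NP` — because under `P = NP` the property
`{f | circuitSizeOver B2 f > 2^{⌊n/4⌋}}` is `P/poly`-natural (constructive, large) and useful
(Razborov–Rudich 1997 §2; Arora–Barak Example 23.2). [cite: AroraBarak2009, Example 23.2]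
[cite: RazborovRudich1997, §2] -/
theorem learning_noNaturalPropertyImpliesPNeNP_proof :
    Summit.PneNP.PneNP.Theses.Learning.LearningNoNaturalPropertyImpliesPNeNP := by
  unfold Summit.PneNP.PneNP.Theses.Learning.LearningNoNaturalPropertyImpliesPNeNP
  intro hno hPNP
  exact hno ⟨fun n => {f | CertifiedHard.quarterExp n < circuitSizeOver B2 f},
    ⟨_, fun n => subset_rfl, learningNoNatural_constructive hPNP, learningNoNatural_large⟩,
    learningNoNatural_useful⟩

end Summit.PneNP.PneNP.Theorems
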